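import Literature.MathematicalPhysics.QuantumFieldTheory.Balaban1983to89.B3DeltaGkZeroNest

/-!
# `Balaban1983to89.B3GkZeroLattice` — T. Bałaban, *(Higgs)₂,₃ quantum fields in a finite volume. III. Renormalization*,
# Commun. Math. Phys. **88** (1983) 411–445 [Balaban1983Higgs3], p. 433: THE INFINITE-VOLUME ZERO-FIELD PROPAGATOR `G_k(0)`
# on `ηℤ^{d+1}` of *"we substitute G_k(□,0) = G_k(0) + δG_k(□,ηZ^d,0)"*, CONSTRUCTED as the limit of the Neumann-box
# propagators of the zero-field box lineage over cubes exhausting the lattice — the Cauchy estimate IS the (2.5) value clause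
# of `B3DeltaGkZeroNest` for nested cubes —, with its symmetry, its invariance under the block lattice, the rate of
# convergence, and the lattice Green identity `(−Δ^η + m² + a_kQ_k^*Q_k)G_k(0) = 1` on the whole lattice

statement-level skeleton of published theorems with citation tags; proofs where landed; nothing here is a claim about the Yang–Mills mass gap

PDF held: `paper:balaban1983-higgs-2-3-quantum-fields-finite-volume` (journal page = PDF page + 410); p. 414 [PDF 4] (the
definition `δG_k(Ω,Ω₂,B̃) = G_k(Ω,B̃) − G_k(Ω₂,B̃)`), p. 424 [PDF 14] ((2.5)–(2.6)), p. 433 [PDF 23] (the substitution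
`G_k(□,0) = G_k(0) + δG_k(□,ηZ^d,0)`) read in the OCR text (`p0004.txt`, `p0014.txt`, `p0023.txt` of the held paper); the cited
source [B4] = T. Bałaban, *Regularity and decay of lattice Green's functions*, Commun. Math. Phys. **89** (1983) 571–597
[Balaban1983RegularityDecay], p. 572 (1.6) (the operators `−Δ^η_{Ω,A} + m² + a_kP_k(A)` and their Green's functions `G_k(Ω,A)`),
as typed by the lineage files imported.

CITATION HEADER (lean-in-tree rule).  Part of the lit-balaban TYPED SKELETON (HOME `run/shared/lean/pub/lit-balaban/`), Phase 2:
SKELETON rows **B3.Eq2.5** (decl of record `B3Sect2StatementsPart2.ScaledKernels.Ineq25`, fold owner r15) and **B3.Txt@433**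
(the p. 433 reduction steps); file 1 of the member «MODEL INSTANCE `A = B̃ = 0`, THE PAIR `(□, ηℤ^{d+1})`» — this file builds the
second propagator of the pair, `G_k(0) = G_k(ηℤ^{d+1}, 0)`, which the tree did not have (the zero-field lineage
`B4Thm110ZeroBox` → `B3Ineq210ZeroBox` → `B3GkZeroBoxSeparated` → `B3DeltaGkZeroNest` lives on finite boxes; the torus files on
`T_η`); file 2 `B3DeltaGkZeroLattice` proves the six kernel clauses of `δG_k(□,ηℤ^{d+1},0)`, file 3 `B3Ineq25ZeroLattice`
discharges (2.5) for the concrete carrier.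

WHAT IS PRINTED.  p. 433 [PDF 23], verbatim: *"Our next operation is the gauge transformation which removes the field B̃₀. …
We get the same expressions as above with B̃₀ = 0 only (and external scalar fields gauge transformed). Finally we replace the
scalar field propagator G_k(□,0) by G_k(0), i.e. we substitute G_k(□,0) = G_k(0) + δG_k(□,ηZ^d,0) and we treat δG_k as an
external scalar field. After all these operations we get a sum of the expressions E(G_ren,{□(v)}_{v∈G_ren},Φ_ext,A_ext) with
localizations in some cube of size O(n) and with the same graphical description as before, but with the scalar field propagator
equal to G_k(0)."*  p. 414 [PDF 4]: *"δG_k(Ω,Ω₂,B̃) = G_k(Ω,B̃) − G_k(Ω₂,B̃). … Also the propagator δG_k(Ω,Ω₂,B̃) will be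
treated as an external field when the estimates of perturbative expressions will be considered."*  p. 424 [PDF 14], (2.5):
*"‖h(an operator δG_k(Ω,Ω₂,B̃) or (1.16))h′‖_{1,α} ≤ O(e^{−δ₀dist(Ω₂,∂Ω)} or (e(L^kε)p(L^kε))^{n+n′})e^{−δ₀dist(supp h, supp h′)}
(2.5) where h, h′ are functions giving the localizations of the vertices."*  p. 414 [PDF 4], after (1.16) (the sentence belongs to
the Hölder-norm estimate of the (1.16) kernel, text layer p0004 L32–33; v1.1 erratum, ref-1 F4-NIT 2026-08-22): *"This estimate follows
easily from the properties of the propagators G_k(Ω,A) proved in the next paper."*  The print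
uses `G_k(0)` — the propagator (1.6) of [B4] at `A = 0` on the WHOLE `η`-lattice (no `Ω`-restriction) — without constructing it;
[B4] p. 573 states its Theorem *"for an arbitrary function f: Ω → R^N"* on regions `Ω` of the lattice.

WHAT IS REPRODUCED, and how (kind «model-instance / infrastructure», G.1 of `HOME/PHASE2-TARGETS.md`).  All in the counting
normalisation of the zero-field box lineage (`n = L^k = η^{−1}` fine points per unit block, `Gfine ℓ k M k a m2 =
(boxOpR n a_k m² M)⁻¹` the Neumann box propagator in matrix units, physical kernels `= η^{−(d+1)}·(matrix units)`):
* §1 the cubes `C_t` of `2t+1` unit blocks per direction exhausting `ℤ^{d+1}` (`cubeM`), the centring shift `ctr n t x = x +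
  nt·1`, label radii (`LabRad`), the nestings `C_t ⊂ C_{t+e}` (`fits_cube`, `emb_ctr`) and THE MARGIN LEMMA `margin_ctr`: a point of
  label radius `≤ R` has gen-6 label margin `≥ t − R` in `C_t` with respect to `C_{t+e}∖C_t`, for every `e`;
* §2 the cube propagators read on the lattice, `gcube ℓ k t a m2 x x′ = G_k(C_t,0;x,x′)` (`0` off the cube), symmetric, and
  `gcube_add_sub_gcube`: `g_{t+e} − g_t` IS gen-6's kernel `B3DeltaGkZeroNest.dGk` of the nested pair `C_t ⊂ C_{t+e}`;
* §3 **THE CAUCHY ESTIMATE** `abs_gcube_sub_le`: `η^{−(d+1)}|g_{t+e}(x,x′) − g_t(x,x′)| ≤ C·e^{−δ₀(t−R)}·e^{−δ₀η|x−x′|_∞}` uniformly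
  in `e`, `k ≥ 1`, the window (= `B3DeltaGkZeroNest.abs_dGk_le`); hence (`cauchySeq_of_le_geometric`) **`tendsto_gcube`**: the
  limit **`GkLat ℓ k a m2 x x′ = G_k(0)(x,x′)`** EXISTS for all `x, x′ ∈ ℤ^{d+1}`, `k ≥ 1`, `a > 0`, `m² ≥ 0`, with the rate
  `abs_GkLat_sub_gcube_le` (`≤ C·e^{−δ₀(t−R)}·e^{−δ₀η|x−x′|_∞}`);
* §4 `GkLat_comm` (symmetry) and **`GkLat_shift`**: `G_k(0)(x + nv, x′ + nv) = G_k(0)(x,x′)` for every block-lattice vector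
  `v ∈ ℤ^{d+1}` (the cube propagators of the translated points are nested-box propagators of `x, x′` for an off-centre nesting,
  `fits_cube_shift`/`margin_ctr_shift`, so both families have the same limit);
* §5 **`green_GkLat`**: `Σ_z H(x,z)G_k(0)(z,x′) = δ_{x,x′}` for ALL `x, x′ ∈ ℤ^{d+1}` with `H = latOpK n a_k m²` = the operator
  `n²(−Δ) + m² + (a_k/n^{d+1})1_{same block}` of [B4] (1.6) at `A = 0` on the whole lattice in matrix units (the row sum over the
  finite support `B4Reflection242.opSupp`, i.e. exactly the hypothesis shape `hGreen` of `B4Reflection242.greenBox_images`), from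
  the lineage's Neumann identity `boxOpR·(boxOpR)⁻¹ = 1` at interior rows of `C_t` (`boxOpR_ctr_ctr`: away from the boundary the
  box operator's row IS the lattice operator's row; `green_gcube`) in the limit `t → ∞` (a finite sum of convergent sequences).

HONEST SCOPE / DECLARED DIVERGENCES (F7).  (i) Zero background field only (`U ≡ 1`, one component; the p. 433 substitution is made
AFTER the gauge step removing `B̃₀`, so zero field is the printed case; a constant `B̃₀` would be the lineage's conjugation
`B3Eq26ConstBox`, not done here); unit blocks (`L^kη = 1`), all `k ≥ 1`, `L ≥ 2`, running coefficient `a_k = B1.aSeq a L k`, window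
`a > 0`, `m² ≥ 0` for existence, `[a₋,a₊] × [0,m²₊]` for the uniform constants.  (ii) `G_k(0)` is constructed as a KERNEL (a real
function of two lattice points) with the Green identity and the convergence rate — not as a bounded operator on `ℓ²(ηℤ^{d+1})`;
uniqueness among bounded solutions, positivity and the scale decomposition (2.6) of `G_k(0)` into pieces `G^η_{(j)}(0)` are NOT
claimed (the nested-box (2.5) estimate controls the full propagator, not its (2.6) pieces).  (iii) Distances in the sup norm,
lattice units `× η` (as the lineage).  (iv) Constants existential, depending on `d`, `L`, the window (print: O(1)).  (v) ROUTE: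
not in print (the print takes `G_k(0)` from [B4] as given); here `G_k(0) := lim_{t→∞} G_k(C_t,0)` along centred cubes, the
existence of the limit being the exponential smallness of `δG_k` for nested boxes — [B4] (1.11)–(1.12) / Cor. 2.3 at `A = 0`,
kernel-proved in the lineage (`B4Delta112ZeroBox` → `B3DeltaGkZeroNest`); the same device as the tree's `B4Sect5Exhaustion` (the
Sect. 5 theorem of [B4] on infinite `Ω` by Dirichlet exhaustion).  Every input is a kernel theorem USED BY NAME
(`B3DeltaGkZeroNest.abs_dGk_le`, `B4BoxCov237.boxOpR_mul_inv`, `B4Thm110ZeroBox.fineOp_top`, `B4Reflection242.card_nbrs`, …);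
plain `def`s of real-valued kernels/predicates and theorems only, no `structure`, no Literature fact minted, no `sorry`; standard
axioms.  Value = the tree now HAS the propagator `G_k(0)` that rows B3.Eq3.3/3.4 ff. («the scalar field propagator equal to
G_k(0)») speak about, as a kernel with its defining identity — infrastructure for the zero-field instance of p. 433, NOT summit
progress.
Unit `lit-balaban-p03` (Phase-2 proof seat p03, gen 8); HOME `run/shared/lean/pub/lit-balaban/` (rows B3.Eq2.5 / B3.Txt@433,
FILED.md, STATUS.md).
-/

namespace Literature.MathematicalPhysics.QuantumFieldTheory.Balaban1983to89.B3GkZeroLattice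

open Finset Matrix Filter Topology
open Literature.MathematicalPhysics.QuantumFieldTheory.Balaban1983to89.B4ContourShift (supNorm supNorm_nonneg
  abs_le_supNorm exists_supNorm_eq)
open Literature.MathematicalPhysics.QuantumFieldTheory.Balaban1983to89.B4TwoRegion120 (supNorm_sub_comm)
open Literature.MathematicalPhysics.QuantumFieldTheory.Balaban1983to89.B4Lower18 (supNorm_sub_le_one_of_mem_nbrs)
open Literature.MathematicalPhysics.QuantumFieldTheory.Balaban1983to89.B4Reflection242
open Literature.MathematicalPhysics.QuantumFieldTheory.Balaban1983to89.B4BoxCov237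
open Literature.MathematicalPhysics.QuantumFieldTheory.Balaban1983to89.B4TwoBox120
open Literature.MathematicalPhysics.QuantumFieldTheory.Balaban1983to89.B4Thm110ZeroBox
open Literature.MathematicalPhysics.QuantumFieldTheory.Balaban1983to89.B3GkZeroBoxSeparated
open Literature.MathematicalPhysics.QuantumFieldTheory.Balaban1983to89.B3DeltaGkZeroNest

noncomputable section

variable {d : ℕ}

/-! ## §1 Centred cubes of unit blocks exhausting `ℤ^{d+1}`, the centring shift, label radii, margins -/

/-- The cube `C_t` of `2t+1` unit blocks per direction (block labels `−t … t` after centring). [cite: Balaban1983Higgs3, (2.5) p.424] -/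
abbrev cubeM (t : ℕ) : Fin (d + 1) → ℕ := fun _ => 2 * t + 1

/-- kernel: the cubes are non-degenerate. [cite: Balaban1983Higgs3, (2.5) p.424] -/
theorem cubeM_pos (t : ℕ) (i : Fin (d + 1)) : 1 ≤ cubeM (d := d) t i := by
  show 1 ≤ 2 * t + 1; omega

/-- The centring shift: the lattice point `x ∈ ℤ^{d+1}` (fine units, `n` points per unit block) read in the coordinates
of the cube `C_t` whose fine box is `Π[0, n(2t+1))`, i.e. `x + nt·(1,…,1)`. [cite: Balaban1983Higgs3, (2.5) p.424] -/
def ctr (n t : ℕ) (x : Fin (d + 1) → ℤ) : Fin (d + 1) → ℤ := x + fun _ => (n : ℤ) * (t : ℤ)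

/-- kernel: coordinates of the centred point. [cite: Balaban1983Higgs3, (2.5) p.424] -/
@[simp] theorem ctr_apply (n t : ℕ) (x : Fin (d + 1) → ℤ) (i : Fin (d + 1)) :
    ctr n t x i = x i + (n : ℤ) * (t : ℤ) := rfl

/-- kernel: centring in a larger cube is centring followed by the nesting translation. [cite: Balaban1983Higgs3, (2.5) p.424] -/
theorem ctr_add (n t e : ℕ) (x : Fin (d + 1) → ℤ) :
    ctr n (t + e) x = ctr n t x + fun _ => (n : ℤ) * (e : ℤ) := by
  funext i; simp only [ctr, Pi.add_apply]; push_cast; ring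

/-- kernel: centring does not change differences. [cite: Balaban1983Higgs3, (2.5) p.424] -/
@[simp] theorem ctr_sub_ctr (n t : ℕ) (x x' : Fin (d + 1) → ℤ) : ctr n t x - ctr n t x' = x - x' := by
  funext i; simp [ctr]

/-- kernel: the block label of the centred point is the label of `x` shifted by `t`. [cite: Balaban1983Higgs3, (2.5) p.424] -/
theorem blk_ctr {n : ℕ} (hn : 1 ≤ n) (t : ℕ) (x : Fin (d + 1) → ℤ) :
    blk n (ctr n t x) = blk n x + fun _ => (t : ℤ) := by
  unfold ctr; exact blk_add_mul hn x _

/-- `x` has LABEL RADIUS `≤ R`: every block label `⌊x_i/n⌋` lies in `[−R, R]`. [cite: Balaban1983Higgs3, (2.5) p.424] -/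
def LabRad (n R : ℕ) (x : Fin (d + 1) → ℤ) : Prop := ∀ i, |blk n x i| ≤ (R : ℤ)

/-- kernel: monotonicity of the label radius. [cite: Balaban1983Higgs3, (2.5) p.424] -/
theorem LabRad.mono {n R R' : ℕ} (h : R ≤ R') {x : Fin (d + 1) → ℤ} (hx : LabRad n R x) : LabRad n R' x :=
  fun i => (hx i).trans (by exact_mod_cast h)

/-- kernel: every point has a finite label radius. [cite: Balaban1983Higgs3, (2.5) p.424] -/
theorem labRad_sum (n : ℕ) (x : Fin (d + 1) → ℤ) : LabRad n (∑ i, (blk n x i).natAbs) x := by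
  intro i
  have h1 : (blk n x i).natAbs ≤ ∑ j, (blk n x j).natAbs :=
    Finset.single_le_sum (f := fun j => (blk n x j).natAbs) (fun _ _ => Nat.zero_le _) (Finset.mem_univ i)
  calc |blk n x i| = ((blk n x i).natAbs : ℤ) := (Int.natCast_natAbs _).symm
    _ ≤ _ := by exact_mod_cast h1

/-- kernel: a common label radius for two points. [cite: Balaban1983Higgs3, (2.5) p.424] -/
theorem exists_labRad₂ (n : ℕ) (x x' : Fin (d + 1) → ℤ) : ∃ R : ℕ, LabRad n R x ∧ LabRad n R x' :=
  ⟨∑ i, (blk n x i).natAbs + ∑ i, (blk n x' i).natAbs, (labRad_sum n x).mono (Nat.le_add_right _ _),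
    (labRad_sum n x').mono (Nat.le_add_left _ _)⟩

/-- kernel: a point of label radius `≤ R ≤ t` lies, after centring, in the fine box of `C_t`. [cite: Balaban1983Higgs3, (2.5) p.424] -/
theorem ctr_mem {n : ℕ} (hn : 1 ≤ n) {R t : ℕ} (hRt : R ≤ t) {x : Fin (d + 1) → ℤ} (hx : LabRad n R x) :
    ctr n t x ∈ boxDom (fun i => n * cubeM (d := d) t i) := by
  rw [mem_boxDom]
  intro i
  have hb := abs_le.1 (hx i)
  have hn0 : (0 : ℤ) < n := by exact_mod_cast hn
  have hRt' : (R : ℤ) ≤ t := by exact_mod_cast hRt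
  have h1 : -(t : ℤ) ≤ x i / n := by have := hb.1; unfold blk at this; linarith
  have h2 : x i / n < t + 1 := by have := hb.2; unfold blk at this; linarith
  have h3 := (Int.le_ediv_iff_mul_le hn0).1 h1
  have h4 := (Int.ediv_lt_iff_lt_mul hn0).1 h2
  refine ⟨?_, ?_⟩
  · simp only [ctr_apply]; linarith
  · simp only [ctr_apply, cubeM]; push_cast; nlinarith

/-- kernel: the cubes are nested, `C_t ⊂ C_{t+e}` with label offset `e` in every direction. [cite: Balaban1983Higgs3, (2.5) p.424] -/
theorem fits_cube (t e : ℕ) : Fits (cubeM (d := d) t) (cubeM (t + e)) (fun _ => (e : ℤ)) := by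
  intro i
  refine ⟨by positivity, ?_⟩
  simp only [cubeM]; push_cast; linarith

/-- kernel: the nesting translation of `C_t ⊂ C_{t+e}` maps the centred point of `C_t` to the centred point of `C_{t+e}`.
[cite: Balaban1983Higgs3, (2.5) p.424] -/
theorem emb_ctr {n : ℕ} (t e : ℕ) {x : Fin (d + 1) → ℤ} (hx : ctr n t x ∈ boxDom (fun i => n * cubeM (d := d) t i))
    (hxe : ctr n (t + e) x ∈ boxDom (fun i => n * cubeM (d := d) (t + e) i)) :
    emb ((fits_cube t e).scale n) ⟨ctr n t x, hx⟩ = ⟨ctr n (t + e) x, hxe⟩ :=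
  Subtype.ext (by
    show ctr n t x + (fun _ => (n : ℤ) * (e : ℤ)) = ctr n (t + e) x
    exact (ctr_add n t e x).symm)

/-- kernel: membership of the translated centred point. [cite: Balaban1983Higgs3, (2.5) p.424] -/
theorem ctr_add_mem {n : ℕ} (t e : ℕ) {x : Fin (d + 1) → ℤ} (hx : ctr n t x ∈ boxDom (fun i => n * cubeM (d := d) t i)) :
    ctr n (t + e) x ∈ boxDom (fun i => n * cubeM (d := d) (t + e) i) := by
  have h := (emb ((fits_cube (d := d) t e).scale n) ⟨ctr n t x, hx⟩).2
  rwa [emb_val, ← ctr_add] at h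

/-- kernel: an integer of absolute value `≥ m` has real cast of absolute value `≥ m`. [folklore] -/
private theorem le_supNorm_of_coord {m : ℤ} {v : Fin (d + 1) → ℤ} (i : Fin (d + 1)) (h : m ≤ |v i|) :
    ((m : ℤ) : ℝ) ≤ supNorm v :=
  le_trans (by exact_mod_cast h) (abs_le_supNorm v i)

/-- **MARGIN OF A CENTRED POINT.**  A point of label radius `≤ R` centred in `C_t`, `R + r ≤ t`, has label margin `≥ r`
with respect to the nesting `C_t ⊂ C_{t+e}` (gen-6 `B3DeltaGkZeroNest.Margin`: every fine point of `C_{t+e}` off the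
translated `C_t` has block label at sup-distance `≥ r + 1` from the label of the point). [cite: Balaban1983Higgs3, (2.5) p.424] -/
theorem margin_ctr {n : ℕ} (hn : 1 ≤ n) {R r t : ℕ} (ht : R + r ≤ t) (e : ℕ) {x : Fin (d + 1) → ℤ}
    (hx : LabRad n R x) (hmem : ctr n t x ∈ boxDom (fun i => n * cubeM (d := d) t i)) :
    Margin n (fits_cube t e) r ⟨ctr n t x, hmem⟩ := by
  intro y hy
  have hn0 : (0 : ℤ) < n := by exact_mod_cast hn
  have hlab : blk n (emb ((fits_cube (d := d) t e).scale n) ⟨ctr n t x, hmem⟩).1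
      = blk n x + fun _ => ((t : ℤ) + e) := by
    rw [emb_ctr t e hmem (ctr_add_mem t e hmem)]
    show blk n (ctr n (t + e) x) = _
    rw [blk_ctr hn]; push_cast; rfl
  have hy0 := (mem_boxDom.1 y.2)
  have hy' : ∃ i, y.1 i < (n : ℤ) * e ∨ (n : ℤ) * (2 * t + 1 + e) ≤ y.1 i := by
    by_contra hcon
    apply hy
    rw [mem_boxDom]
    intro i
    have hi : ¬ (y.1 i < (n : ℤ) * e ∨ (n : ℤ) * (2 * t + 1 + e) ≤ y.1 i) := fun h => hcon ⟨i, h⟩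
    rw [not_or, not_lt, not_le] at hi
    refine ⟨by simp only [Pi.sub_apply]; linarith, ?_⟩
    simp only [Pi.sub_apply, cubeM]; push_cast; linarith
  obtain ⟨i, hi⟩ := hy'
  have hxi := abs_le.1 (hx i)
  simp only [blk] at hxi
  have hRt : (R : ℤ) + r ≤ t := by exact_mod_cast ht
  have key : (r : ℤ) + 1 ≤ |(blk n (emb ((fits_cube (d := d) t e).scale n) ⟨ctr n t x, hmem⟩).1 - blk n y.1) i| := by
    rw [hlab]
    simp only [Pi.sub_apply, Pi.add_apply]
    rcases hi with hi | hi
    · -- `y_i < ne`: the label of `y` is `≤ e − 1`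
      have h1 : y.1 i / n < e := (Int.ediv_lt_iff_lt_mul hn0).2 (by linarith)
      rw [abs_of_nonneg (by unfold blk; linarith)]
      unfold blk; linarith
    · -- `y_i ≥ n(2t+1+e)`: the label of `y` is `≥ 2t+1+e`
      have h1 : 2 * (t : ℤ) + 1 + e ≤ y.1 i / n := (Int.le_ediv_iff_mul_le hn0).2 (by linarith)
      rw [abs_of_nonpos (by unfold blk; linarith)]
      unfold blk; linarith
  have := le_supNorm_of_coord i key
  push_cast at this
  exact this

/-! ## §2 The zero-field box propagators of the centred cubes read on `ℤ^{d+1}` -/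

/-- **`g_t(x,x′) = G_k(C_t, 0; x, x′)`**: the zero-field propagator (`Gfine`, matrix units, [B4] (1.6) at `A = 0` with
Neumann conditions, scale `k`, `n = L^k` fine points per unit block, running `a_k = B1.aSeq a L k`, mass `m²`) of the
centred cube `C_t` of `2t+1` unit blocks per direction, read at two points of `ℤ^{d+1}` (and `0` when one of them is not
in `C_t`). [cite: Balaban1983Higgs3, (2.6) p.424] -/
def gcube (ℓ k t : ℕ) (a m2 : ℝ) (x x' : Fin (d + 1) → ℤ) : ℝ :=
  if h : ctr ((ℓ + 1) ^ k) t x ∈ boxDom (Nf ℓ k (cubeM t)) ∧ ctr ((ℓ + 1) ^ k) t x' ∈ boxDom (Nf ℓ k (cubeM t)) then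
    Gfine ℓ k (cubeM t) k a m2 ⟨_, h.1⟩ ⟨_, h.2⟩ else 0

section Cube

variable {ℓ k : ℕ} {a m2 : ℝ}

/-- `g_t` at two points of `C_t` is the box propagator. [cite: Balaban1983Higgs3, (2.6) p.424] -/
theorem gcube_eq {t : ℕ} {x x' : Fin (d + 1) → ℤ} (hx : ctr ((ℓ + 1) ^ k) t x ∈ boxDom (Nf ℓ k (cubeM t)))
    (hx' : ctr ((ℓ + 1) ^ k) t x' ∈ boxDom (Nf ℓ k (cubeM t))) :
    gcube ℓ k t a m2 x x' = Gfine ℓ k (cubeM t) k a m2 ⟨_, hx⟩ ⟨_, hx'⟩ := by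
  rw [gcube, dif_pos ⟨hx, hx'⟩]

/-- `g_t` is symmetric. [cite: Balaban1983Higgs3, (2.6) p.424] -/
theorem gcube_comm (t : ℕ) (x x' : Fin (d + 1) → ℤ) : gcube ℓ k t a m2 x x' = gcube ℓ k t a m2 x' x := by
  by_cases h : ctr ((ℓ + 1) ^ k) t x ∈ boxDom (Nf ℓ k (cubeM t)) ∧ ctr ((ℓ + 1) ^ k) t x' ∈ boxDom (Nf ℓ k (cubeM t))
  · rw [gcube_eq h.1 h.2, gcube_eq h.2 h.1]
    exact (Gfine_isSymm ℓ k (cubeM t) k a m2).apply _ _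
  · rw [gcube, dif_neg h, gcube, dif_neg (fun h' => h ⟨h'.2, h'.1⟩)]

/-- **THE NESTED DIFFERENCE IS gen-6's `δG_k`**: `g_{t+e}(x,x′) − g_t(x,x′) = δG_k(C_{t+e}, C_t, 0)` at the centred
points (`B3DeltaGkZeroNest.dGk` for the nested pair `C_t ⊂ C_{t+e}`). [cite: Balaban1983Higgs3, (2.5) p.424] -/
theorem gcube_add_sub_gcube (t e : ℕ) {x x' : Fin (d + 1) → ℤ}
    (hx : ctr ((ℓ + 1) ^ k) t x ∈ boxDom (Nf ℓ k (cubeM t))) (hx' : ctr ((ℓ + 1) ^ k) t x' ∈ boxDom (Nf ℓ k (cubeM t))) :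
    gcube ℓ k (t + e) a m2 x x' - gcube ℓ k t a m2 x x'
      = dGk ℓ k (fits_cube t e) a m2 ⟨ctr ((ℓ + 1) ^ k) t x, hx⟩ ⟨ctr ((ℓ + 1) ^ k) t x', hx'⟩ := by
  rw [dGk, emb_ctr t e hx (ctr_add_mem t e hx), emb_ctr t e hx' (ctr_add_mem t e hx'),
    gcube_eq (ctr_add_mem t e hx) (ctr_add_mem t e hx'), gcube_eq hx hx']

end Cube

/-! ## §3 The Cauchy estimate (= gen-6's (2.5) value clause for nested cubes) and the limit `G_k(0)` -/

/-- **THE CAUCHY ESTIMATE.**  For points of label radius `≤ R` and cubes `C_t ⊂ C_{t+e}` with `t ≥ R + 3`: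
`η^{−(d+1)}|g_{t+e}(x,x′) − g_t(x,x′)| ≤ C·e^{−δ₀(t−R)}·e^{−δ₀η|x−x′|_∞}`, uniformly in `e`, the scale `k ≥ 1` and the
window — gen-6's value clause `B3DeltaGkZeroNest.abs_dGk_le` for the nested pair, the points having label margin `t − R`.
[cite: Balaban1983Higgs3, (2.5) p.424] -/
theorem abs_gcube_sub_le (d ℓ : ℕ) (hℓ : 1 ≤ ℓ) (amin aplus m2plus : ℝ) (ha : 0 < amin) :
    ∃ δ₀ C : ℝ, 0 < δ₀ ∧ 0 < C ∧ ∀ (k : ℕ), 1 ≤ k → ∀ (a m2 : ℝ), amin ≤ a → a ≤ aplus → 0 ≤ m2 → m2 ≤ m2plus →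
      ∀ (R t e : ℕ), R + 3 ≤ t → ∀ (x x' : Fin (d + 1) → ℤ), LabRad ((ℓ + 1) ^ k) R x → LabRad ((ℓ + 1) ^ k) R x' →
        ((((ℓ + 1) ^ k : ℕ)) : ℝ) ^ (d + 1) * |gcube ℓ k (t + e) a m2 x x' - gcube ℓ k t a m2 x x'|
          ≤ C * Real.exp (-(δ₀ * ((t : ℝ) - R))) *
            Real.exp (-(δ₀ * (supNorm (x - x') / ((((ℓ + 1) ^ k : ℕ)) : ℝ)))) := by
  obtain ⟨δ₀, C, hδ₀, hC, h⟩ := abs_dGk_le d ℓ hℓ amin aplus m2plus ha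
  refine ⟨δ₀, C, hδ₀, hC, ?_⟩
  intro k hk a m2 h1 h2 h3 h4 R t e ht x x' hx hx'
  have hn : 1 ≤ (ℓ + 1) ^ k := Nat.one_le_pow _ _ (by omega)
  have hRt : R ≤ t := by omega
  have hxm := ctr_mem (d := d) hn hRt hx
  have hxm' := ctr_mem (d := d) hn hRt hx'
  have hmx := margin_ctr hn (show R + (t - R) ≤ t by omega) e hx hxm
  have hmx' := margin_ctr hn (show R + (t - R) ≤ t by omega) e hx' hxm'
  have hb := h k hk a m2 h1 h2 h3 h4 (cubeM t) (cubeM (t + e)) _ (fits_cube t e) (cubeM_pos t) (t - R) (by omega)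
    ⟨_, hxm⟩ ⟨_, hxm'⟩ hmx hmx'
  rw [← gcube_add_sub_gcube t e hxm hxm', Nat.cast_sub hRt] at hb
  simpa only [ctr_sub_ctr] using hb

/-- **`G_k(0)(x,x′)`, THE INFINITE-VOLUME ZERO-FIELD PROPAGATOR on `ηℤ^{d+1}` in matrix units** (the physical kernel of
p. 433 is `η^{−(d+1)}·GkLat`): the limit of the Neumann-cube propagators `g_t(x,x′)` as the cubes `C_t` exhaust the
lattice (it exists: `tendsto_gcube`). [cite: Balaban1983Higgs3, p.433 («we substitute G_k(□,0) = G_k(0) + δG_k(□,ηZ^d,0)»)] -/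
def GkLat (ℓ k : ℕ) (a m2 : ℝ) (x x' : Fin (d + 1) → ℤ) : ℝ :=
  limUnder atTop fun t => gcube ℓ k t a m2 x x'

/-- kernel: `e^{−c(m+3)} = e^{−3c}·(e^{−c})^m`. [folklore] -/
private theorem exp_neg_mul_add_three (c : ℝ) (m : ℕ) :
    Real.exp (-(c * ((m : ℝ) + 3))) = Real.exp (-(c * 3)) * Real.exp (-c) ^ m := by
  rw [← Real.exp_nat_mul, ← Real.exp_add]; ring_nf

/-- **EXISTENCE OF THE INFINITE-VOLUME LIMIT.**  For `k ≥ 1`, `a > 0`, `m² ≥ 0` and every pair of lattice points the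
cube propagators `g_t(x,x′)` converge as `t → ∞` (to `GkLat`): by the Cauchy estimate the sequence is geometrically
Cauchy. [cite: Balaban1983Higgs3, p.433 («we substitute G_k(□,0) = G_k(0) + δG_k(□,ηZ^d,0)»)] -/
theorem tendsto_gcube {ℓ k : ℕ} (hℓ : 1 ≤ ℓ) (hk : 1 ≤ k) {a m2 : ℝ} (ha : 0 < a) (hm : 0 ≤ m2)
    (x x' : Fin (d + 1) → ℤ) :
    Tendsto (fun t => gcube ℓ k t a m2 x x') atTop (𝓝 (GkLat ℓ k a m2 x x')) := by
  obtain ⟨R, hx, hx'⟩ := exists_labRad₂ ((ℓ + 1) ^ k) x x'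
  obtain ⟨δ₀, C, hδ₀, hC, h⟩ := abs_gcube_sub_le d ℓ hℓ a a m2 ha
  set u : ℕ → ℝ := fun m => gcube ℓ k (m + (R + 3)) a m2 x x' with hu
  have hL : (1 : ℝ) ≤ ((((ℓ + 1) ^ k : ℕ)) : ℝ) ^ (d + 1) := one_le_pow₀ (by exact_mod_cast Nat.one_le_pow _ _ (by omega))
  have hstep : ∀ m, dist (u m) (u (m + 1)) ≤ C * Real.exp (-(δ₀ * 3)) * Real.exp (-δ₀) ^ m := by
    intro m
    have hb := h k hk a m2 le_rfl le_rfl hm le_rfl R (m + (R + 3)) 1 (by omega) x x' hx hx'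
    rw [show m + (R + 3) + 1 = m + 1 + (R + 3) by ring] at hb
    have hE : Real.exp (-(δ₀ * (supNorm (x - x') / ((((ℓ + 1) ^ k : ℕ)) : ℝ)))) ≤ 1 :=
      Real.exp_le_one_iff.2 (by
        have := div_nonneg (supNorm_nonneg (x - x')) (Nat.cast_nonneg ((ℓ + 1) ^ k)); nlinarith)
    have hT : Real.exp (-(δ₀ * (((m + (R + 3) : ℕ) : ℝ) - R))) = Real.exp (-(δ₀ * 3)) * Real.exp (-δ₀) ^ m := by
      rw [← exp_neg_mul_add_three]; congr 1; push_cast; ring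
    rw [dist_comm, Real.dist_eq]
    calc |u (m + 1) - u m| ≤ ((((ℓ + 1) ^ k : ℕ)) : ℝ) ^ (d + 1) * |u (m + 1) - u m| :=
          le_mul_of_one_le_left (abs_nonneg _) hL
      _ ≤ C * Real.exp (-(δ₀ * (((m + (R + 3) : ℕ) : ℝ) - R))) *
            Real.exp (-(δ₀ * (supNorm (x - x') / ((((ℓ + 1) ^ k : ℕ)) : ℝ)))) := hb
      _ ≤ C * Real.exp (-(δ₀ * (((m + (R + 3) : ℕ) : ℝ) - R))) * 1 :=
          mul_le_mul_of_nonneg_left hE (by positivity)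
      _ = C * Real.exp (-(δ₀ * 3)) * Real.exp (-δ₀) ^ m := by rw [mul_one, hT, mul_assoc]
  have hcs : CauchySeq u :=
    cauchySeq_of_le_geometric (Real.exp (-δ₀)) (C * Real.exp (-(δ₀ * 3))) (Real.exp_lt_one_iff.2 (by linarith)) hstep
  obtain ⟨G, hG⟩ := cauchySeq_tendsto_of_complete hcs
  exact tendsto_nhds_limUnder ⟨G, (tendsto_add_atTop_iff_nat (f := fun t => gcube ℓ k t a m2 x x') (R + 3)).1 hG⟩

/-- kernel: a bound valid along a convergent sequence passes to the limit (with a fixed non-negative weight and a fixed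
comparison term). [folklore] -/
private theorem mul_abs_sub_le_of_tendsto {f : ℕ → ℝ} {A c g B : ℝ} (hf : Tendsto f atTop (𝓝 A)) (T : ℕ)
    (hB : ∀ t, T ≤ t → c * |f t - g| ≤ B) : c * |A - g| ≤ B :=
  le_of_tendsto ((hf.sub_const g).abs.const_mul c) (eventually_atTop.2 ⟨T, hB⟩)

/-- **RATE OF CONVERGENCE**: `η^{−(d+1)}|G_k(0)(x,x′) − g_t(x,x′)| ≤ C·e^{−δ₀(t−R)}·e^{−δ₀η|x−x′|_∞}` for points of label
radius `≤ R` and `t ≥ R + 3`, uniformly in `k ≥ 1` and the window (the Cauchy estimate in the limit `e → ∞`).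
[cite: Balaban1983Higgs3, p.433 («we substitute G_k(□,0) = G_k(0) + δG_k(□,ηZ^d,0)»)] -/
theorem abs_GkLat_sub_gcube_le (d ℓ : ℕ) (hℓ : 1 ≤ ℓ) (amin aplus m2plus : ℝ) (ha : 0 < amin) :
    ∃ δ₀ C : ℝ, 0 < δ₀ ∧ 0 < C ∧ ∀ (k : ℕ), 1 ≤ k → ∀ (a m2 : ℝ), amin ≤ a → a ≤ aplus → 0 ≤ m2 → m2 ≤ m2plus →
      ∀ (R t : ℕ), R + 3 ≤ t → ∀ (x x' : Fin (d + 1) → ℤ), LabRad ((ℓ + 1) ^ k) R x → LabRad ((ℓ + 1) ^ k) R x' →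
        ((((ℓ + 1) ^ k : ℕ)) : ℝ) ^ (d + 1) * |GkLat ℓ k a m2 x x' - gcube ℓ k t a m2 x x'|
          ≤ C * Real.exp (-(δ₀ * ((t : ℝ) - R))) *
            Real.exp (-(δ₀ * (supNorm (x - x') / ((((ℓ + 1) ^ k : ℕ)) : ℝ)))) := by
  obtain ⟨δ₀, C, hδ₀, hC, h⟩ := abs_gcube_sub_le d ℓ hℓ amin aplus m2plus ha
  refine ⟨δ₀, C, hδ₀, hC, ?_⟩
  intro k hk a m2 h1 h2 h3 h4 R t ht x x' hx hx'
  have hconv : Tendsto (fun e => gcube ℓ k (e + t) a m2 x x') atTop (𝓝 (GkLat ℓ k a m2 x x')) :=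
    (tendsto_add_atTop_iff_nat (f := fun t' => gcube ℓ k t' a m2 x x') t).2
      (tendsto_gcube hℓ hk (ha.trans_le h1) h3 x x')
  refine mul_abs_sub_le_of_tendsto hconv 0 fun e _ => ?_
  rw [add_comm e t]
  exact h k hk a m2 h1 h2 h3 h4 R t e ht x x' hx hx'

/-- kernel: a weighted absolute bound valid along a convergent sequence passes to the limit. [folklore] -/
private theorem mul_abs_le_of_tendsto {F : ℕ → ℝ} {A c B : ℝ} (hF : Tendsto F atTop (𝓝 A)) (T : ℕ)
    (hB : ∀ t, T ≤ t → c * |F t| ≤ B) : c * |A| ≤ B :=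
  le_of_tendsto (hF.abs.const_mul c) (eventually_atTop.2 ⟨T, hB⟩)

/-! ## §4 Structure of `G_k(0)`: symmetry and invariance under block-lattice translations -/

section Structure

variable {ℓ k : ℕ} {a m2 : ℝ}

/-- `G_k(0)` is a symmetric kernel. [cite: Balaban1983Higgs3, p.433 («we substitute G_k(□,0) = G_k(0) + δG_k(□,ηZ^d,0)»)] -/
theorem GkLat_comm (x x' : Fin (d + 1) → ℤ) : GkLat ℓ k a m2 x x' = GkLat ℓ k a m2 x' x := by
  unfold GkLat
  congr 1
  funext t
  exact gcube_comm t x x'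

/-- kernel: the cubes are nested, `C_t ⊂ C_{t+e}`, also with a block-lattice offset `e·1 − v`, `|v_i| ≤ e`. [cite: Balaban1983Higgs3, (2.5) p.424] -/
theorem fits_cube_shift (t e : ℕ) {v : Fin (d + 1) → ℤ} (hv : ∀ i, |v i| ≤ (e : ℤ)) :
    Fits (cubeM (d := d) t) (cubeM (t + e)) (fun i => (e : ℤ) - v i) := by
  intro i
  have := abs_le.1 (hv i)
  refine ⟨by linarith, ?_⟩
  simp only [cubeM]; push_cast; linarith

/-- kernel: label radius of a block-translated point. [cite: Balaban1983Higgs3, (2.5) p.424] -/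
theorem labRad_add_blockVec {n : ℕ} (hn : 1 ≤ n) {R V : ℕ} {x v : Fin (d + 1) → ℤ} (hx : LabRad n R x)
    (hv : ∀ i, |v i| ≤ (V : ℤ)) : LabRad n (R + V) (x + fun i => (n : ℤ) * v i) := by
  intro i
  rw [blk_add_mul hn, Pi.add_apply]
  have := abs_add_le (blk n x i) (v i)
  push_cast
  linarith [hx i, hv i]

/-- kernel: under the offset nesting the centred translated point goes to the centred point of the larger cube. [cite: Balaban1983Higgs3, (2.5) p.424] -/
theorem emb_ctr_shift {n : ℕ} (t e : ℕ) {v : Fin (d + 1) → ℤ} (hv : ∀ i, |v i| ≤ (e : ℤ)) {x : Fin (d + 1) → ℤ}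
    (hx : ctr n t (x + fun i => (n : ℤ) * v i) ∈ boxDom (fun i => n * cubeM (d := d) t i))
    (hxe : ctr n (t + e) x ∈ boxDom (fun i => n * cubeM (d := d) (t + e) i)) :
    emb ((fits_cube_shift t e hv).scale n) ⟨ctr n t (x + fun i => (n : ℤ) * v i), hx⟩ = ⟨ctr n (t + e) x, hxe⟩ :=
  Subtype.ext (by
    show ctr n t (x + fun i => (n : ℤ) * v i) + (fun i => (n : ℤ) * ((e : ℤ) - v i)) = ctr n (t + e) x
    funext i; simp only [ctr, Pi.add_apply]; push_cast; ring)

/-- kernel: membership of the centred point of the larger cube, offset nesting. [cite: Balaban1983Higgs3, (2.5) p.424] -/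
theorem ctr_add_mem_shift {n : ℕ} (t e : ℕ) {v : Fin (d + 1) → ℤ} (hv : ∀ i, |v i| ≤ (e : ℤ)) {x : Fin (d + 1) → ℤ}
    (hx : ctr n t (x + fun i => (n : ℤ) * v i) ∈ boxDom (fun i => n * cubeM (d := d) t i)) :
    ctr n (t + e) x ∈ boxDom (fun i => n * cubeM (d := d) (t + e) i) := by
  have h := (emb ((fits_cube_shift (d := d) t e hv).scale n) ⟨ctr n t (x + fun i => (n : ℤ) * v i), hx⟩).2
  have heq : (emb ((fits_cube_shift (d := d) t e hv).scale n) ⟨ctr n t (x + fun i => (n : ℤ) * v i), hx⟩).1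
      = ctr n (t + e) x := by
    rw [emb_val]
    show ctr n t (x + fun i => (n : ℤ) * v i) + (fun i => (n : ℤ) * ((e : ℤ) - v i)) = ctr n (t + e) x
    funext i; simp only [ctr, Pi.add_apply]; push_cast; ring
  rwa [heq] at h

/-- **MARGIN, OFFSET NESTING**: the translated point `x + n·v` (`|v|_∞ ≤ V ≤ e`, label radius of `x` `≤ R`) centred in
`C_t`, `R + V + r ≤ t`, has label margin `≥ r` for the nesting `C_t ⊂ C_{t+e}` with offset `e·1 − v`. [cite: Balaban1983Higgs3, (2.5) p.424] -/
theorem margin_ctr_shift {n : ℕ} (hn : 1 ≤ n) {R V r t : ℕ} (ht : R + V + r ≤ t) (e : ℕ) {v : Fin (d + 1) → ℤ}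
    (hvV : ∀ i, |v i| ≤ (V : ℤ)) (hve : ∀ i, |v i| ≤ (e : ℤ)) {x : Fin (d + 1) → ℤ} (hx : LabRad n R x)
    (hmem : ctr n t (x + fun i => (n : ℤ) * v i) ∈ boxDom (fun i => n * cubeM (d := d) t i)) :
    Margin n (fits_cube_shift t e hve) r ⟨ctr n t (x + fun i => (n : ℤ) * v i), hmem⟩ := by
  intro y hy
  have hn0 : (0 : ℤ) < n := by exact_mod_cast hn
  have hlab : blk n (emb ((fits_cube_shift (d := d) t e hve).scale n) ⟨ctr n t (x + fun i => (n : ℤ) * v i), hmem⟩).1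
      = blk n x + fun _ => ((t : ℤ) + e) := by
    rw [emb_ctr_shift t e hve hmem (ctr_add_mem_shift t e hve hmem)]
    show blk n (ctr n (t + e) x) = _
    rw [blk_ctr hn]; push_cast; rfl
  have hy0 := (mem_boxDom.1 y.2)
  have hy' : ∃ i, y.1 i < (n : ℤ) * ((e : ℤ) - v i) ∨ (n : ℤ) * (2 * t + 1 + ((e : ℤ) - v i)) ≤ y.1 i := by
    by_contra hcon
    apply hy
    rw [mem_boxDom]
    intro i
    have hi : ¬ (y.1 i < (n : ℤ) * ((e : ℤ) - v i) ∨ (n : ℤ) * (2 * t + 1 + ((e : ℤ) - v i)) ≤ y.1 i) :=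
      fun h => hcon ⟨i, h⟩
    rw [not_or, not_lt, not_le] at hi
    refine ⟨by simp only [Pi.sub_apply]; linarith, ?_⟩
    simp only [Pi.sub_apply, cubeM]; push_cast; linarith
  obtain ⟨i, hi⟩ := hy'
  have hxi := abs_le.1 (hx i)
  simp only [blk] at hxi
  have hvi := abs_le.1 (hvV i)
  have hRt : (R : ℤ) + V + r ≤ t := by exact_mod_cast ht
  have key : (r : ℤ) + 1 ≤
      |(blk n (emb ((fits_cube_shift (d := d) t e hve).scale n) ⟨ctr n t (x + fun i => (n : ℤ) * v i), hmem⟩).1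
        - blk n y.1) i| := by
    rw [hlab]
    simp only [Pi.sub_apply, Pi.add_apply]
    rcases hi with hi | hi
    · have h1 : y.1 i / n < (e : ℤ) - v i := (Int.ediv_lt_iff_lt_mul hn0).2 (by linarith)
      rw [abs_of_nonneg (by unfold blk; linarith)]
      unfold blk; linarith
    · have h1 : 2 * (t : ℤ) + 1 + ((e : ℤ) - v i) ≤ y.1 i / n := (Int.le_ediv_iff_mul_le hn0).2 (by linarith)
      rw [abs_of_nonpos (by unfold blk; linarith)]
      unfold blk; linarith
  have := le_supNorm_of_coord i key
  push_cast at this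
  exact this

/-- kernel: `C·e^{δ₀S}·e^{−δ₀t} → 0` as `t → ∞` along the naturals. [folklore] -/
private theorem tendsto_const_mul_exp_neg {δ₀ : ℝ} (hδ₀ : 0 < δ₀) (K S : ℝ) :
    Tendsto (fun t : ℕ => K * Real.exp (-(δ₀ * ((t : ℝ) - S)))) atTop (𝓝 0) := by
  have h1 : Tendsto (fun t : ℕ => δ₀ * ((t : ℝ) - S)) atTop atTop :=
    Tendsto.const_mul_atTop hδ₀ (tendsto_atTop_add_const_right _ (-S)
      (tendsto_natCast_atTop_atTop.congr (fun n => by ring)) |>.congr (fun n => by ring))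
  have h2 := Real.tendsto_exp_neg_atTop_nhds_zero.comp h1
  simpa using h2.const_mul K

/-- **`G_k(0)` IS INVARIANT UNDER THE BLOCK LATTICE**: `G_k(0)(x + nv, x′ + nv) = G_k(0)(x, x′)` for every `v ∈ ℤ^{d+1}`
(`n = L^k` fine points per unit block; the averaging operator `Q_k` is invariant under block translations only).  The cube
propagators of `x + nv, x′ + nv` are nested-box propagators of `x, x′` for an off-centre nesting, so both families have
the same limit by gen-6's (2.5) value clause. [cite: Balaban1983Higgs3, p.433 («we substitute G_k(□,0) = G_k(0) + δG_k(□,ηZ^d,0)»)] -/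
theorem GkLat_shift (hℓ : 1 ≤ ℓ) (hk : 1 ≤ k) (ha : 0 < a) (hm : 0 ≤ m2) (x x' v : Fin (d + 1) → ℤ) :
    GkLat ℓ k a m2 (x + fun i => (((ℓ + 1) ^ k : ℕ) : ℤ) * v i) (x' + fun i => (((ℓ + 1) ^ k : ℕ) : ℤ) * v i)
      = GkLat ℓ k a m2 x x' := by
  have hn : 1 ≤ (ℓ + 1) ^ k := Nat.one_le_pow _ _ (by omega)
  obtain ⟨R, hx, hx'⟩ := exists_labRad₂ ((ℓ + 1) ^ k) x x'
  set V : ℕ := ∑ i, (v i).natAbs with hV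
  have hvV : ∀ i, |v i| ≤ (V : ℤ) := fun i => by
    have h1 : (v i).natAbs ≤ ∑ j, (v j).natAbs :=
      Finset.single_le_sum (f := fun j => (v j).natAbs) (fun _ _ => Nat.zero_le _) (Finset.mem_univ i)
    calc |v i| = ((v i).natAbs : ℤ) := (Int.natCast_natAbs _).symm
      _ ≤ _ := by exact_mod_cast h1
  set xv := x + fun i => (((ℓ + 1) ^ k : ℕ) : ℤ) * v i with hxv
  set xv' := x' + fun i => (((ℓ + 1) ^ k : ℕ) : ℤ) * v i with hxv'
  have hxvR : LabRad ((ℓ + 1) ^ k) (R + V) xv := labRad_add_blockVec hn hx hvV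
  have hxvR' : LabRad ((ℓ + 1) ^ k) (R + V) xv' := labRad_add_blockVec hn hx' hvV
  obtain ⟨δ₀, C, hδ₀, hC, h⟩ := abs_dGk_le d ℓ hℓ a a m2 ha
  -- the off-centre nested bound, uniform in `e ≥ V`
  have hbd : ∀ t, R + V + 3 ≤ t → ∀ e, V ≤ e →
      |gcube ℓ k (t + e) a m2 x x' - gcube ℓ k t a m2 xv xv'| ≤ C * Real.exp (-(δ₀ * ((t : ℝ) - (R + V)))) := by
    intro t ht e he
    have hve : ∀ i, |v i| ≤ (e : ℤ) := fun i => (hvV i).trans (by exact_mod_cast he)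
    have hm1 := ctr_mem (d := d) hn (show R + V ≤ t by omega) hxvR
    have hm1' := ctr_mem (d := d) hn (show R + V ≤ t by omega) hxvR'
    have hm2 := ctr_add_mem_shift t e hve hm1
    have hm2' := ctr_add_mem_shift t e hve hm1'
    have hmar := margin_ctr_shift hn (show R + V + (t - (R + V)) ≤ t by omega) e hvV hve hx hm1
    have hmar' := margin_ctr_shift hn (show R + V + (t - (R + V)) ≤ t by omega) e hvV hve hx' hm1'
    have hb := h k hk a m2 le_rfl le_rfl hm le_rfl (cubeM t) (cubeM (t + e)) _ (fits_cube_shift t e hve) (cubeM_pos t)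
      (t - (R + V)) (by omega) ⟨_, hm1⟩ ⟨_, hm1'⟩ hmar hmar'
    rw [dGk, emb_ctr_shift t e hve hm1 hm2, emb_ctr_shift t e hve hm1' hm2', ← gcube_eq hm2 hm2', ← gcube_eq hm1 hm1',
      Nat.cast_sub (show R + V ≤ t by omega)] at hb
    have hL : (1 : ℝ) ≤ ((((ℓ + 1) ^ k : ℕ)) : ℝ) ^ (d + 1) := one_le_pow₀ (by exact_mod_cast hn)
    have hE : Real.exp (-(δ₀ * (supNorm ((ctr ((ℓ + 1) ^ k) t xv) - (ctr ((ℓ + 1) ^ k) t xv')) /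
        ((((ℓ + 1) ^ k : ℕ)) : ℝ)))) ≤ 1 :=
      Real.exp_le_one_iff.2 (by
        have := div_nonneg (supNorm_nonneg ((ctr ((ℓ + 1) ^ k) t xv) - (ctr ((ℓ + 1) ^ k) t xv')))
          (Nat.cast_nonneg ((ℓ + 1) ^ k)); nlinarith)
    rw [Nat.cast_add] at hb
    calc |gcube ℓ k (t + e) a m2 x x' - gcube ℓ k t a m2 xv xv'|
        ≤ ((((ℓ + 1) ^ k : ℕ)) : ℝ) ^ (d + 1) * |gcube ℓ k (t + e) a m2 x x' - gcube ℓ k t a m2 xv xv'| :=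
          le_mul_of_one_le_left (abs_nonneg _) hL
      _ ≤ C * Real.exp (-(δ₀ * ((t : ℝ) - (R + V)))) * Real.exp (-(δ₀ * (supNorm ((ctr ((ℓ + 1) ^ k) t xv) -
            (ctr ((ℓ + 1) ^ k) t xv')) / ((((ℓ + 1) ^ k : ℕ)) : ℝ)))) := hb
      _ ≤ C * Real.exp (-(δ₀ * ((t : ℝ) - (R + V)))) * 1 := mul_le_mul_of_nonneg_left hE (by positivity)
      _ = _ := mul_one _
  -- `e → ∞`: the limit of the unshifted family is within the same bound of the shifted cube propagator
  have hlim : ∀ t, R + V + 3 ≤ t → |GkLat ℓ k a m2 x x' - gcube ℓ k t a m2 xv xv'| ≤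
      C * Real.exp (-(δ₀ * ((t : ℝ) - (R + V)))) := by
    intro t ht
    have hconv : Tendsto (fun e => gcube ℓ k (e + t) a m2 x x') atTop (𝓝 (GkLat ℓ k a m2 x x')) :=
      (tendsto_add_atTop_iff_nat (f := fun t' => gcube ℓ k t' a m2 x x') t).2 (tendsto_gcube hℓ hk ha hm x x')
    have := mul_abs_sub_le_of_tendsto (c := 1) hconv V fun e he => by
      rw [one_mul, add_comm e t]; exact hbd t ht e he
    simpa using this
  -- `t → ∞`: the shifted cube propagators converge to `GkLat x x′`
  have hT : Tendsto (fun t => gcube ℓ k t a m2 xv xv') atTop (𝓝 (GkLat ℓ k a m2 x x')) := by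
    rw [← tendsto_sub_nhds_zero_iff]
    refine squeeze_zero_norm' (eventually_atTop.2 ⟨R + V + 3, fun t ht => ?_⟩)
      (tendsto_const_mul_exp_neg hδ₀ C ((R : ℝ) + V))
    rw [Real.norm_eq_abs, abs_sub_comm]
    exact hlim t ht
  exact tendsto_nhds_unique (tendsto_gcube hℓ hk ha hm xv xv') hT

end Structure

/-! ## §5 `G_k(0)` is the Green's function of `−Δ^η + m² + a_kQ_k^*Q_k` on the whole lattice `ηℤ^{d+1}` -/

section Green

/-- The operator `−Δ^η + m² + a_kQ_k^*Q_k` of [B4] (1.6) at `A = 0` ON THE WHOLE LATTICE `ηℤ^{d+1}`, as a kernel in matrix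
units (`n = η^{−1}` fine points per unit block): `n²(−Δ) + m² + (a_k/n^{d+1})·1_{same n-block}` — the lineage's box operator
`B4BoxCov237.boxOpR n a_k m² M` is its Neumann restriction to the fine box `Π[0,nM)` (`boxOpR_ctr_ctr`), and
`B4Reflection242.opK` is its complex-coefficient twin. [cite: Balaban1983RegularityDecay, (1.6) p.572] -/
def latOpK (n : ℕ) (A m2 : ℝ) (x z : Fin (d + 1) → ℤ) : ℝ :=
  ((n : ℝ)) ^ 2 * lapK x z + (diagK m2 x z + avgK (A * (((n : ℝ)) ^ (d + 1))⁻¹) n x z)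

/-- the lattice operator's row at `x` is supported on `B4Reflection242.opSupp n x` (the point, its neighbours, its block).
[cite: Balaban1983RegularityDecay, (1.6) p.572] -/
theorem latOpK_eq_zero {n : ℕ} (hn : 1 ≤ n) (A m2 : ℝ) {x z : Fin (d + 1) → ℤ} (hz : z ∉ opSupp n x) :
    latOpK n A m2 x z = 0 := by
  simp only [opSupp, Finset.mem_union, Finset.mem_insert, not_or] at hz
  obtain ⟨⟨hzx, hzn⟩, hzb⟩ := hz
  have hblk : blk n z ≠ blk n x := fun h => hzb ((mem_blockOf hn).2 h)
  simp [latOpK, lapK, diagK, avgK, hzx, hzn, hblk]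

/-- kernel: a point of the operator support of `x` is within fine sup-distance `n` of `x`, coordinatewise. [cite: Balaban1983RegularityDecay, (1.6) p.572] -/
theorem abs_le_of_mem_opSupp {n : ℕ} (hn : 1 ≤ n) {x z : Fin (d + 1) → ℤ} (hz : z ∈ opSupp n x) (i : Fin (d + 1)) :
    |z i| ≤ |x i| + n := by
  have key : |z i - x i| ≤ (n : ℤ) := by
    simp only [opSupp, Finset.mem_union, Finset.mem_insert] at hz
    rcases hz with (rfl | hzn) | hzb
    · simp
    · have h3 : ((|(x - z) i| : ℤ) : ℝ) ≤ 1 := (abs_le_supNorm (x - z) i).trans (supNorm_sub_le_one_of_mem_nbrs hzn)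
      have h4 : |x i - z i| ≤ 1 := by exact_mod_cast h3
      rw [abs_sub_comm]
      exact h4.trans (by exact_mod_cast hn)
    · have h3 : ((|(z - x) i| : ℤ) : ℝ) ≤ (n : ℝ) - 1 :=
        (abs_le_supNorm (z - x) i).trans (supNorm_sub_le_of_blk_eq hn ((mem_blockOf hn).1 hzb))
      have h4 : ((|z i - x i| : ℤ) : ℝ) ≤ (n : ℝ) - 1 := by simpa using h3
      exact_mod_cast (h4.trans (by linarith : (n : ℝ) - 1 ≤ (n : ℝ)))
  have := abs_sub_abs_le_abs_sub (z i) (x i)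
  linarith

/-- kernel: a point with `|z_i| ≤ nt` for all `i` lies in `C_t` after centring (`n ≥ 1`). [cite: Balaban1983RegularityDecay, (1.6) p.572] -/
theorem ctr_mem_of_abs_le {n : ℕ} (hn : 1 ≤ n) {t : ℕ} {z : Fin (d + 1) → ℤ} (hz : ∀ i, |z i| ≤ (n : ℤ) * t) :
    ctr n t z ∈ boxDom (fun i => n * cubeM (d := d) t i) := by
  rw [mem_boxDom]
  intro i
  have := abs_le.1 (hz i)
  have hn1 : (1 : ℤ) ≤ n := by exact_mod_cast hn
  refine ⟨by simp only [ctr_apply]; linarith, ?_⟩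
  simp only [ctr_apply, cubeM]; push_cast; nlinarith

/-- **THE BOX OPERATOR IS THE LATTICE OPERATOR AWAY FROM THE BOUNDARY**: at a centred point all of whose lattice neighbours
lie in the fine box of `C_t`, the row of `boxOpR n a m² C_t` read through the centring is the row of the lattice operator.
[cite: Balaban1983RegularityDecay, (1.6) p.572] -/
theorem boxOpR_ctr_ctr {n : ℕ} (hn : 1 ≤ n) (A m2 : ℝ) {t : ℕ} {x z : Fin (d + 1) → ℤ}
    (hx : ctr n t x ∈ boxDom (fun i => n * cubeM (d := d) t i))
    (hz : ctr n t z ∈ boxDom (fun i => n * cubeM (d := d) t i))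
    (hN : ∀ w ∈ nbrs (ctr n t x), w ∈ boxDom (fun i => n * cubeM (d := d) t i)) :
    boxOpR n A m2 (cubeM t) ⟨ctr n t x, hx⟩ ⟨ctr n t z, hz⟩ = latOpK n A m2 x z := by
  have hinj : (ctr n t z = ctr n t x) ↔ z = x := (add_left_injective _).eq_iff
  have hnb : ctr n t z ∈ nbrs (ctr n t x) ↔ z ∈ nbrs x := by
    unfold ctr; rw [mem_nbrs_add_iff]; simp
  have hbl : (blk n (ctr n t z) = blk n (ctr n t x)) ↔ blk n z = blk n x := by
    rw [blk_ctr hn, blk_ctr hn]; exact (add_left_injective _).eq_iff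
  have e1 : (neumannLapK (fun i => n * cubeM (d := d) t i) (ctr n t x) (ctr n t z) : ℝ) = lapK x z := by
    by_cases hzx : z = x
    · subst hzx
      simp only [neumannLapK, lapK, if_true]
      rw [Finset.filter_true_of_mem hN, card_nbrs]
    · have h1 : ctr n t z ≠ ctr n t x := fun h => hzx (hinj.1 h)
      by_cases hzn : z ∈ nbrs x
      · simp [neumannLapK, lapK, h1, hzx, hnb.2 hzn, hzn]
      · simp [neumannLapK, lapK, h1, hzx, mt hnb.1 hzn, hzn]
  have e2 : (diagK m2 (ctr n t x) (ctr n t z) : ℝ) = diagK m2 x z := by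
    by_cases hzx : z = x
    · subst hzx; simp [diagK]
    · simp [diagK, hzx, mt hinj.1 hzx]
  have e3 : (avgK (A * (((n : ℝ)) ^ (d + 1))⁻¹) n (ctr n t x) (ctr n t z) : ℝ)
      = avgK (A * (((n : ℝ)) ^ (d + 1))⁻¹) n x z := by
    by_cases hzb : blk n z = blk n x
    · simp [avgK, hzb, hbl.2 hzb]
    · simp [avgK, hzb, mt hbl.1 hzb]
  simp only [boxOpR, opBoxR, Matrix.of_apply, latOpK]
  rw [e1, e2, e3]

/-- **THE GREEN IDENTITY OF THE CUBE PROPAGATORS READ ON THE LATTICE**: for `t` so large that the whole operator support of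
`x` sits in `C_t` (`|x_i| + n ≤ nt`) and `x′ ∈ C_t`, `Σ_z H(x,z)·g_t(z,x′) = δ_{x,x′}` with `H` the lattice operator — the
Neumann box identity `boxOpR·Gfine = 1` of the lineage at an interior row. [cite: Balaban1983RegularityDecay, (1.6) p.572] -/
theorem green_gcube {ℓ k : ℕ} (hℓ : 1 ≤ ℓ) (hk : 1 ≤ k) {a m2 : ℝ} (ha : 0 < a) (hm : 0 ≤ m2) {t : ℕ}
    {x x' : Fin (d + 1) → ℤ} (hx : ∀ i, |x i| + (((ℓ + 1) ^ k : ℕ) : ℤ) ≤ (((ℓ + 1) ^ k : ℕ) : ℤ) * t)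
    (hx' : ctr ((ℓ + 1) ^ k) t x' ∈ boxDom (Nf ℓ k (cubeM t))) :
    ∑ z ∈ opSupp ((ℓ + 1) ^ k) x, latOpK ((ℓ + 1) ^ k) (B1.aSeq a ((ℓ : ℝ) + 1) k) m2 x z * gcube ℓ k t a m2 z x'
      = if x = x' then 1 else 0 := by
  have hn : 1 ≤ (ℓ + 1) ^ k := Nat.one_le_pow _ _ (by omega)
  have hsupp : ∀ z ∈ opSupp ((ℓ + 1) ^ k) x, ctr ((ℓ + 1) ^ k) t z ∈ boxDom (Nf ℓ k (cubeM t)) := fun z hz =>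
    ctr_mem_of_abs_le (d := d) hn (fun i => (abs_le_of_mem_opSupp hn hz i).trans (hx i))
  have hxs : x ∈ opSupp ((ℓ + 1) ^ k) x := by simp [opSupp]
  have hxm : ctr ((ℓ + 1) ^ k) t x ∈ boxDom (Nf ℓ k (cubeM t)) := hsupp x hxs
  have hcw : ∀ w : Fin (d + 1) → ℤ, ctr ((ℓ + 1) ^ k) t (w - fun _ => ((((ℓ + 1) ^ k : ℕ)) : ℤ) * (t : ℤ)) = w :=
    fun w => by funext i; simp [ctr]
  have hN : ∀ w ∈ nbrs (ctr ((ℓ + 1) ^ k) t x), w ∈ boxDom (Nf ℓ k (cubeM t)) := by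
    intro w hw
    have h1 : (w - fun _ => ((((ℓ + 1) ^ k : ℕ)) : ℤ) * (t : ℤ)) ∈ nbrs x := by
      rw [← mem_nbrs_add_iff]; exact hw
    have h2 := hsupp (w - fun _ => ((((ℓ + 1) ^ k : ℕ)) : ℤ) * (t : ℤ))
      (Finset.mem_union_left _ (Finset.mem_insert_of_mem h1))
    rwa [hcw] at h2
  set A := B1.aSeq a ((ℓ : ℝ) + 1) k with hA_def
  have hA : 0 < A := B1.aSeq_pos ha (one_lt_L_real hℓ) hk
  have hG : Gfine ℓ k (cubeM t) k a m2 = (boxOpR ((ℓ + 1) ^ k) A m2 (cubeM (d := d) t))⁻¹ := by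
    unfold Gfine; rw [fineOp_top]
  have hmat := boxOpR_mul_inv hn hA hm (cubeM_pos (d := d) t)
  have happ : (boxOpR ((ℓ + 1) ^ k) A m2 (cubeM (d := d) t) * (boxOpR ((ℓ + 1) ^ k) A m2 (cubeM (d := d) t))⁻¹)
      ⟨ctr ((ℓ + 1) ^ k) t x, hxm⟩ ⟨ctr ((ℓ + 1) ^ k) t x', hx'⟩
        = if x = x' then 1 else 0 := by
    rw [hmat, Matrix.one_apply]
    have : (⟨ctr ((ℓ + 1) ^ k) t x, hxm⟩ : ↥(boxDom (Nf ℓ k (cubeM t)))) = ⟨ctr ((ℓ + 1) ^ k) t x', hx'⟩ ↔ x = x' := by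
      rw [Subtype.mk.injEq]; exact (add_left_injective _).eq_iff
    simp only [this]
  rw [Matrix.mul_apply] at happ
  rw [← happ]
  -- read the box sum on the lattice
  set c : Fin (d + 1) → ℤ := fun _ => ((((ℓ + 1) ^ k : ℕ)) : ℤ) * (t : ℤ) with hc
  set gl : (Fin (d + 1) → ℤ) → ℝ := fun w =>
    if h : w ∈ boxDom (Nf ℓ k (cubeM t)) then
      (boxOpR ((ℓ + 1) ^ k) A m2 (cubeM (d := d) t))⁻¹ ⟨w, h⟩ ⟨ctr ((ℓ + 1) ^ k) t x', hx'⟩ else 0 with hgl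
  have step1 : ∑ Y : ↥(boxDom (Nf ℓ k (cubeM t))),
      boxOpR ((ℓ + 1) ^ k) A m2 (cubeM (d := d) t) ⟨ctr ((ℓ + 1) ^ k) t x, hxm⟩ Y *
        (boxOpR ((ℓ + 1) ^ k) A m2 (cubeM (d := d) t))⁻¹ Y ⟨ctr ((ℓ + 1) ^ k) t x', hx'⟩
      = ∑ Y : ↥(boxDom (Nf ℓ k (cubeM t))), latOpK ((ℓ + 1) ^ k) A m2 x (Y.1 - c) * gl Y.1 := by
    refine Finset.sum_congr rfl fun Y _ => ?_
    have hY : Y = ⟨ctr ((ℓ + 1) ^ k) t (Y.1 - c), by rw [hcw]; exact Y.2⟩ := Subtype.ext (hcw Y.1).symm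
    have hgY : gl Y.1 = (boxOpR ((ℓ + 1) ^ k) A m2 (cubeM (d := d) t))⁻¹ Y ⟨ctr ((ℓ + 1) ^ k) t x', hx'⟩ := by
      rw [hgl]; simp only [Y.2, dif_pos]
    rw [hgY]
    congr 1
    conv_lhs => rw [hY]
    exact boxOpR_ctr_ctr hn A m2 hxm _ hN
  have step2 : ∑ Y : ↥(boxDom (Nf ℓ k (cubeM t))), latOpK ((ℓ + 1) ^ k) A m2 x (Y.1 - c) * gl Y.1
      = ∑ w ∈ boxDom (Nf ℓ k (cubeM t)), latOpK ((ℓ + 1) ^ k) A m2 x (w - c) * gl w :=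
    Finset.sum_coe_sort (boxDom (Nf ℓ k (cubeM t))) (fun w => latOpK ((ℓ + 1) ^ k) A m2 x (w - c) * gl w)
  have himg : (opSupp ((ℓ + 1) ^ k) x).image (fun z => z + c) ⊆ boxDom (Nf ℓ k (cubeM t)) := by
    intro w hw
    obtain ⟨z, hz, rfl⟩ := Finset.mem_image.1 hw
    exact hsupp z hz
  have step3 : ∑ w ∈ (opSupp ((ℓ + 1) ^ k) x).image (fun z => z + c), latOpK ((ℓ + 1) ^ k) A m2 x (w - c) * gl w
      = ∑ w ∈ boxDom (Nf ℓ k (cubeM t)), latOpK ((ℓ + 1) ^ k) A m2 x (w - c) * gl w := by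
    refine Finset.sum_subset himg fun w _ hw => ?_
    have hz : w - c ∉ opSupp ((ℓ + 1) ^ k) x := fun h =>
      hw (Finset.mem_image.2 ⟨w - c, h, sub_add_cancel w c⟩)
    rw [latOpK_eq_zero hn A m2 hz, zero_mul]
  have step4 : ∑ w ∈ (opSupp ((ℓ + 1) ^ k) x).image (fun z => z + c), latOpK ((ℓ + 1) ^ k) A m2 x (w - c) * gl w
      = ∑ z ∈ opSupp ((ℓ + 1) ^ k) x, latOpK ((ℓ + 1) ^ k) A m2 x (z + c - c) * gl (z + c) :=
    Finset.sum_image fun z _ z' _ h => add_left_injective c h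
  rw [step1, step2, ← step3, step4]
  refine Finset.sum_congr rfl fun z hz => ?_
  rw [add_sub_cancel_right]
  congr 1
  have hzc : z + c = ctr ((ℓ + 1) ^ k) t z := rfl
  rw [gcube_eq (hsupp z hz) hx', hG, hgl]
  simp only [hzc, hsupp z hz, dif_pos]

/-- **`G_k(0)` IS THE GREEN'S FUNCTION OF `−Δ^η + m² + a_kQ_k^*Q_k` ON `ηℤ^{d+1}`**: for all lattice points `x, x′`,
`Σ_z H(x,z)·G_k(0)(z,x′) = δ_{x,x′}` (matrix units, `H = latOpK`, the sum over the finite operator support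
`B4Reflection242.opSupp`, i.e. the shape `hGreen` of `B4Reflection242.greenBox_images`), `k ≥ 1`, `a > 0`, `m² ≥ 0`.
[cite: Balaban1983Higgs3, p.433 («we substitute G_k(□,0) = G_k(0) + δG_k(□,ηZ^d,0)»)] -/
theorem green_GkLat {ℓ k : ℕ} (hℓ : 1 ≤ ℓ) (hk : 1 ≤ k) {a m2 : ℝ} (ha : 0 < a) (hm : 0 ≤ m2)
    (x x' : Fin (d + 1) → ℤ) :
    ∑ z ∈ opSupp ((ℓ + 1) ^ k) x, latOpK ((ℓ + 1) ^ k) (B1.aSeq a ((ℓ : ℝ) + 1) k) m2 x z * GkLat ℓ k a m2 z x'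
      = if x = x' then 1 else 0 := by
  have hn : 1 ≤ (ℓ + 1) ^ k := Nat.one_le_pow _ _ (by omega)
  have hn1 : (1 : ℤ) ≤ (((ℓ + 1) ^ k : ℕ) : ℤ) := by exact_mod_cast hn
  set T : ℕ := ∑ i, (x i).natAbs + ∑ i, (x' i).natAbs + 1 with hT
  have hTeq : (T : ℤ) = ∑ i, |x i| + ∑ i, |x' i| + 1 := by rw [hT]; push_cast; ring
  have hS : 0 ≤ ∑ i, |x i| := Finset.sum_nonneg fun i _ => abs_nonneg (x i)
  have hS' : 0 ≤ ∑ i, |x' i| := Finset.sum_nonneg fun i _ => abs_nonneg (x' i)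
  have hxT : ∀ i, |x i| + 1 ≤ (T : ℤ) := fun i => by
    have h1 : |x i| ≤ ∑ j, |x j| :=
      Finset.single_le_sum (f := fun j => |x j|) (fun j _ => abs_nonneg (x j)) (Finset.mem_univ i)
    rw [hTeq]; linarith
  have hxT' : ∀ i, |x' i| ≤ (T : ℤ) := fun i => by
    have h1 : |x' i| ≤ ∑ j, |x' j| :=
      Finset.single_le_sum (f := fun j => |x' j|) (fun j _ => abs_nonneg (x' j)) (Finset.mem_univ i)
    rw [hTeq]; linarith
  have hlim : Tendsto (fun t => ∑ z ∈ opSupp ((ℓ + 1) ^ k) x,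
      latOpK ((ℓ + 1) ^ k) (B1.aSeq a ((ℓ : ℝ) + 1) k) m2 x z * gcube ℓ k t a m2 z x') atTop
      (𝓝 (∑ z ∈ opSupp ((ℓ + 1) ^ k) x, latOpK ((ℓ + 1) ^ k) (B1.aSeq a ((ℓ : ℝ) + 1) k) m2 x z * GkLat ℓ k a m2 z x')) :=
    tendsto_finsetSum _ fun z _ => (tendsto_gcube hℓ hk ha hm z x').const_mul _
  have hev : ∀ t, T ≤ t → (∑ z ∈ opSupp ((ℓ + 1) ^ k) x,
      latOpK ((ℓ + 1) ^ k) (B1.aSeq a ((ℓ : ℝ) + 1) k) m2 x z * gcube ℓ k t a m2 z x') = if x = x' then 1 else 0 := by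
    intro t ht
    have ht' : (T : ℤ) ≤ t := by exact_mod_cast ht
    refine green_gcube hℓ hk ha hm (fun i => ?_) (ctr_mem_of_abs_le (d := d) hn fun i => ?_)
    · have := abs_nonneg (x i); nlinarith [hxT i]
    · nlinarith [hxT' i, abs_nonneg (x' i)]
  exact tendsto_nhds_unique hlim
    (tendsto_const_nhds.congr' (eventually_atTop.2 ⟨T, fun t ht => (hev t ht).symm⟩))

end Green


end

end Literature.MathematicalPhysics.QuantumFieldTheory.Balaban1983to89.B3GkZeroLattice
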